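import Summits.Parity.GeneralizedHardyLittlewood.Theorems.LeeYangFibresAbsoluteUpgradeSinglesDecayLocal
import Literature.NumberTheory.Sieve.LinearEquationsInPrimesDimOne
import Literature.NumberTheory.Sieve.SieveFramework
import Mathlib.NumberTheory.ArithmeticFunction.Liouville
import Mathlib.Data.Int.CardIntervalMod
import HarnessLib

/-!
# Route `LeeYangFibres`, crux `AbsoluteUpgrade` (stmt-Parity-14116), line `nlc-cells-absolute-clip`:
# helper file 6 for the stub `stub_singlesDecay` — the dictionary between rough tuples of a
# one-dimensional system and sifted values of its product polynomial

For a system `Ψ` of `t` forms on `ℤ` and the rough threshold `N^{1/u}` put `z = ⌊N^{1/u}⌋ + 1`, so that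
the primes `< z` are exactly the primes `≤ N^{1/u}`.

* `sum_filter_latticeBox` — sums over `[-N, N]¹ ⊆ ℤ¹` are sums over `[-N, N] ⊆ ℤ`;
* `rough_iff_coprime` — for `v ≥ 2`: `P⁻(v) > N^{1/u} ↔ (v, P(z)) = 1`;
* `abs_sum_rough_sub_sum_coprime_le` — on an index set `I` where every `ψ_k ≥ 1`, the sum of a
  bounded function over the ROUGH points (`P⁻(ψ_k(m)) > N^{1/u}` for all `k`) and over the SIFTED points
  (`(∏_k ψ_k(m), P(z)) = 1`) differ by at most `t` (the points with some `ψ_k(m) = 1`);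
* `card_filter_liouville_eq` — sign classes: `#{m ∈ T : λ(a m + b) = ν} = ½ #T + ½ ν ∑_{m ∈ T} λ(a m + b)`;
* `abs_card_Icc_filter_modEq_sub_le` — a class modulo `d` meets an integer interval `[m₁, m₂]` in
  `#[m₁, m₂]/d + O(1)` points.

References: H. Halberstam, H.-E. Richert, *Sieve Methods* (1974), Ch. 1 [HalberstamRichert1974];
B. Green, T. Tao, Ann. of Math. 171 (2010), §1 [GreenTao2010].
-/

noncomputable section

open Finset Polynomial ArithmeticFunction

namespace Summit.Parity.GeneralizedHardyLittlewood.Theorems.AbsoluteUpgrade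

open Literature.NumberTheory.Sieve

variable {t : ℕ}

/-! ### Sums over the box `[-N, N]¹` -/

/-- Sums over the box `[-N, N]¹` are sums over the integer interval `[-N, N]` (`n ↦ n₀`,
`m ↦ (m)`; the tree's `DimOne.card_filter_latticeBox` is the case of counts). [folklore] -/
theorem sum_filter_latticeBox (N : ℕ) (Q : (Fin 1 → ℤ) → Prop) [DecidablePred Q]
    (g : (Fin 1 → ℤ) → ℝ) :
    ∑ n ∈ (latticeBox 1 N).filter Q, g n =
      ∑ m ∈ (Finset.Icc (-(N : ℤ)) N).filter (fun m => Q (fun _ => m)), g (fun _ => m) := by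
  -- adapted from `Literature.NumberTheory.Sieve.DimOne.card_filter_latticeBox`
  refine Finset.sum_nbij' (fun n => n 0) (fun m _ => m) (fun n hn => ?_) (fun m hm => ?_)
    (fun n _ => ?_) (fun m _ => rfl) (fun n _ => ?_)
  · rw [Finset.mem_filter] at hn ⊢
    have h1 : n = fun _ => n 0 := by funext i; rw [Fin.fin_one_eq_zero i]
    refine ⟨?_, h1 ▸ hn.2⟩
    exact Finset.mem_Icc.mpr (by
      have := Fintype.mem_piFinset.mp hn.1 0
      exact Finset.mem_Icc.mp this)
  · rw [Finset.mem_filter] at hm ⊢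
    exact ⟨Fintype.mem_piFinset.mpr fun _ => hm.1, hm.2⟩
  · funext i; simp [Fin.fin_one_eq_zero i]
  · congr 1; funext i; rw [Fin.fin_one_eq_zero i]

/-! ### Rough values versus sifted values -/

/-- The primes `< z = ⌊y⌋ + 1` are the primes `≤ y` (`y ≥ 0`). [folklore] -/
theorem mem_primesBelow_floor_succ_iff {y : ℝ} (hy : 0 ≤ y) {q : ℕ} :
    q ∈ Nat.primesBelow ⌈(((⌊y⌋₊ + 1 : ℕ) : ℝ))⌉₊ ↔ q.Prime ∧ (q : ℝ) ≤ y := by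
  rw [Nat.ceil_natCast, Nat.mem_primesBelow, Nat.lt_succ_iff, Nat.le_floor_iff hy, and_comm]

/-- **Rough iff sifted**: for `v ≥ 2` and `z = ⌊N^{1/u}⌋ + 1`,
`N^{1/u} < P⁻(v) ↔ (v, P(z)) = 1`. [folklore] -/
theorem rough_iff_coprime {y : ℝ} (hy : 0 ≤ y) {v : ℕ} (hv : 2 ≤ v) :
    y < (Nat.minFac v : ℝ) ↔ v.Coprime (primesProdBelow (((⌊y⌋₊ + 1 : ℕ) : ℝ))) := by
  rw [coprime_primesProdBelow_iff]
  constructor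
  · intro h q hq hqv
    obtain ⟨hqp, hqy⟩ := (mem_primesBelow_floor_succ_iff hy).mp hq
    have : (Nat.minFac v : ℝ) ≤ q := by exact_mod_cast Nat.minFac_le_of_dvd hqp.two_le hqv
    linarith
  · intro h
    by_contra hle
    push Not at hle
    have hv1 : v ≠ 1 := by omega
    exact h (Nat.minFac v) ((mem_primesBelow_floor_succ_iff hy).mpr ⟨Nat.minFac_prime hv1, hle⟩)
      (Nat.minFac_dvd v)

/-- A prime divides `|∏_k v_k|` iff it divides some `v_k`. [folklore] -/
theorem prime_dvd_natAbs_prod_iff {ι : Type*} (s : Finset ι) (f : ι → ℤ) {q : ℕ} (hq : q.Prime) :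
    q ∣ (∏ k ∈ s, f k).natAbs ↔ ∃ k ∈ s, (q : ℤ) ∣ f k := by
  rw [← Int.natCast_dvd, (Nat.prime_iff_prime_int.mp hq).dvd_finsetProd_iff]

/-- **Rough points versus sifted points.** On an index set `I ⊆ ℤ` on which every form is `≥ 1`, with
`N^{1/u} ≥ 1` and `z = ⌊N^{1/u}⌋ + 1`: a point with every `ψ_k(m)` rough (`P⁻ > N^{1/u}`) is sifted
(`(∏_k ψ_k(m), P(z)) = 1`), and a sifted point is rough unless some `ψ_k(m) = 1`. [folklore] -/
theorem rough_subset_coprime (Ψ : Fin t → AffLinForm 1) {I : Finset ℤ}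
    (hI : ∀ m ∈ I, ∀ k, 1 ≤ (Ψ k).eval (fun _ => m)) {y : ℝ} (hy : 1 ≤ y) :
    I.filter (fun m : ℤ => ∀ k, y < (Nat.minFac ((Ψ k).eval (fun _ => m)).toNat : ℝ)) ⊆
      I.filter (fun m : ℤ => ((sysPoly Ψ).eval m).natAbs.Coprime
        (primesProdBelow (((⌊y⌋₊ + 1 : ℕ) : ℝ)))) ∧
    I.filter (fun m : ℤ => ((sysPoly Ψ).eval m).natAbs.Coprime
        (primesProdBelow (((⌊y⌋₊ + 1 : ℕ) : ℝ)))) \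
      I.filter (fun m : ℤ => ∀ k, y < (Nat.minFac ((Ψ k).eval (fun _ => m)).toNat : ℝ)) ⊆
      I.filter (fun m : ℤ => ∃ k, (Ψ k).eval (fun _ => m) = 1) := by
  have hy0 : 0 ≤ y := by linarith
  -- values as natural numbers
  have hval : ∀ m ∈ I, ∀ k, ((((Ψ k).eval (fun _ => m)).toNat : ℕ) : ℤ) = (Ψ k).eval (fun _ => m) :=
    fun m hm k => Int.toNat_of_nonneg (by have := hI m hm k; linarith)
  -- coprimality of the product, form by form
  have hcop : ∀ m ∈ I, ((sysPoly Ψ).eval m).natAbs.Coprime (primesProdBelow (((⌊y⌋₊ + 1 : ℕ) : ℝ))) ↔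
      ∀ k, (((Ψ k).eval (fun _ => m)).toNat).Coprime (primesProdBelow (((⌊y⌋₊ + 1 : ℕ) : ℝ))) := by
    intro m hm
    simp only [coprime_primesProdBelow_iff]
    rw [sysPoly_eval]
    constructor
    · intro h k q hq hqk
      refine h q hq ((prime_dvd_natAbs_prod_iff _ _ (Nat.prime_of_mem_primesBelow hq)).mpr
        ⟨k, Finset.mem_univ k, ?_⟩)
      rw [← hval m hm k]
      exact Int.natCast_dvd_natCast.mpr hqk
    · intro h q hq hqprod
      obtain ⟨k, -, hk⟩ := (prime_dvd_natAbs_prod_iff _ _ (Nat.prime_of_mem_primesBelow hq)).mp hqprod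
      refine h k q hq ?_
      rw [← hval m hm k] at hk
      exact Int.natCast_dvd_natCast.mp hk
  constructor
  · intro m hm
    rw [Finset.mem_filter] at hm ⊢
    refine ⟨hm.1, (hcop m hm.1).mpr fun k => ?_⟩
    have hk := hm.2 k
    have h2 : 2 ≤ ((Ψ k).eval (fun _ => m)).toNat := by
      by_contra hlt
      push Not at hlt
      have h1 : ((Ψ k).eval (fun _ => m)).toNat = 1 := by
        have := hI m hm.1 k
        have h0 : 1 ≤ ((Ψ k).eval (fun _ => m)).toNat := by
          have := hval m hm.1 k; omega
        omega
      rw [h1, Nat.minFac_one, Nat.cast_one] at hk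
      linarith
    exact (rough_iff_coprime hy0 h2).mp hk
  · intro m hm
    rw [Finset.mem_sdiff, Finset.mem_filter, Finset.mem_filter] at hm
    obtain ⟨⟨hmI, hc⟩, hnr⟩ := hm
    rw [Finset.mem_filter]
    refine ⟨hmI, ?_⟩
    by_contra hne
    push Not at hne
    refine hnr ⟨hmI, fun k => ?_⟩
    have h2 : 2 ≤ ((Ψ k).eval (fun _ => m)).toNat := by
      have := hI m hmI k
      have := hne k
      have := hval m hmI k
      omega
    exact (rough_iff_coprime hy0 h2).mpr ((hcop m hmI).mp hc k)

/-- Each form takes the value `1` at most once, so at most `t` points of `I` have some `ψ_k = 1`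
(`a_k ≠ 0`). [folklore] -/
theorem card_filter_exists_eval_eq_one_le {Ψ : Fin t → AffLinForm 1} (hΨ : IsNondegenerateSystem Ψ)
    (I : Finset ℤ) : #(I.filter (fun m : ℤ => ∃ k, (Ψ k).eval (fun _ => m) = 1)) ≤ t := by
  have hsub : I.filter (fun m : ℤ => ∃ k, (Ψ k).eval (fun _ => m) = 1) ⊆
      Finset.univ.biUnion fun k => I.filter fun m : ℤ => (Ψ k).eval (fun _ => m) = 1 := by
    intro m hm
    rw [Finset.mem_filter] at hm
    obtain ⟨k, hk⟩ := hm.2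
    exact Finset.mem_biUnion.mpr ⟨k, Finset.mem_univ k, Finset.mem_filter.mpr ⟨hm.1, hk⟩⟩
  have hone : ∀ k, #(I.filter fun m : ℤ => (Ψ k).eval (fun _ => m) = 1) ≤ 1 := by
    intro k
    refine Finset.card_le_one.mpr fun m hm m' hm' => ?_
    rw [Finset.mem_filter, DimOne.eval_eq] at hm hm'
    have ha := coeff_ne_zero_of_nondegenerate hΨ k
    have : (Ψ k).coeff 0 * (m - m') = 0 := by linear_combination hm.2 - hm'.2
    rcases mul_eq_zero.mp this with h | h
    · exact absurd h ha
    · linarith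
  calc _ ≤ #(Finset.univ.biUnion fun k => I.filter fun m : ℤ => (Ψ k).eval (fun _ => m) = 1) :=
        Finset.card_le_card hsub
    _ ≤ ∑ k, #(I.filter fun m : ℤ => (Ψ k).eval (fun _ => m) = 1) := Finset.card_biUnion_le
    _ ≤ ∑ _k : Fin t, 1 := Finset.sum_le_sum fun k _ => hone k
    _ = t := by simp

/-- **The rough sum and the sifted sum differ by at most `t`** for a summand bounded by `1`.
[folklore] -/
theorem abs_sum_rough_sub_sum_coprime_le : ∀ {t : ℕ} {Ψ : Fin t → AffLinForm 1}, IsNondegenerateSystem Ψ → ∀ {I : Finset ℤ}, (∀ m ∈ I, ∀ k, 1 ≤ (Ψ k).eval (fun _ => m)) → ∀ {y : ℝ}, 1 ≤ y → ∀ (g : ℤ → ℝ), (∀ m, |g m| ≤ 1) → |∑ m ∈ I.filter (fun m : ℤ => ∀ k, y < (Nat.minFac ((Ψ k).eval (fun _ => m)).toNat : ℝ)), g m - ∑ m ∈ I.filter (fun m : ℤ => ((sysPoly Ψ).eval m).natAbs.Coprime (primesProdBelow (((⌊y⌋₊ + 1 : ℕ) : ℝ)))), g m| ≤ t := by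
  intro t Ψ hΨ I hI y hy g hg
  obtain ⟨hsub, hdiff⟩ := rough_subset_coprime Ψ hI hy
  have e : ∑ m ∈ I.filter (fun m : ℤ => ∀ k, y < (Nat.minFac ((Ψ k).eval (fun _ => m)).toNat : ℝ)), g m -
      ∑ m ∈ I.filter (fun m : ℤ => ((sysPoly Ψ).eval m).natAbs.Coprime
        (primesProdBelow (((⌊y⌋₊ + 1 : ℕ) : ℝ)))), g m =
      -∑ m ∈ I.filter (fun m : ℤ => ((sysPoly Ψ).eval m).natAbs.Coprime
          (primesProdBelow (((⌊y⌋₊ + 1 : ℕ) : ℝ)))) \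
        I.filter (fun m : ℤ => ∀ k, y < (Nat.minFac ((Ψ k).eval (fun _ => m)).toNat : ℝ)), g m := by
    rw [← Finset.sum_sdiff hsub]; ring
  rw [e, abs_neg]
  calc _ ≤ ∑ m ∈ _, |g m| := Finset.abs_sum_le_sum_abs _ _
    _ ≤ ∑ _m ∈ _, (1 : ℝ) := Finset.sum_le_sum fun m _ => hg m
    _ = #(I.filter (fun m : ℤ => ((sysPoly Ψ).eval m).natAbs.Coprime
          (primesProdBelow (((⌊y⌋₊ + 1 : ℕ) : ℝ)))) \
        I.filter (fun m : ℤ => ∀ k, y < (Nat.minFac ((Ψ k).eval (fun _ => m)).toNat : ℝ))) := by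
        simp
    _ ≤ #(I.filter (fun m : ℤ => ∃ k, (Ψ k).eval (fun _ => m) = 1)) := by
        exact_mod_cast Finset.card_le_card hdiff
    _ ≤ t := by exact_mod_cast card_filter_exists_eval_eq_one_le hΨ I

/-! ### Sign classes -/

/-- `λ(n) ∈ {1, −1}` for `n ≠ 0`. [folklore] -/
theorem liouville_eq_one_or_eq_neg_one {n : ℕ} (hn : n ≠ 0) : liouville n = 1 ∨ liouville n = -1 := by
  rw [liouville_apply hn]
  rcases Nat.even_or_odd (cardFactors n) with h | h
  · left; exact h.neg_one_pow
  · right; exact h.neg_one_pow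

/-- **Counting a sign class**: if `a m + b ≥ 1` on `T` and `ν ∈ {±1}`,
`#{m ∈ T : λ(a m + b) = ν} = ½ #T + ½ ν ∑_{m ∈ T} λ(a m + b)`. [folklore] -/
theorem card_filter_liouville_eq (T : Finset ℤ) {a b : ℤ} (hT : ∀ m ∈ T, 1 ≤ a * m + b) {ν : ℤ}
    (hν : ν = 1 ∨ ν = -1) :
    (#(T.filter (fun m : ℤ => liouville (a * m + b).toNat = ν)) : ℝ) =
      (1 / 2) * #T + (1 / 2) * ν * ∑ m ∈ T, (liouville (a * m + b).toNat : ℝ) := by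
  -- adapted from `Literature.NumberTheory.Sieve.LiouvilleSifted.card_signClass_eq`
  rw [Finset.card_eq_sum_ones, Nat.cast_sum, Finset.sum_filter, Finset.card_eq_sum_ones,
    Nat.cast_sum, Finset.mul_sum, Finset.mul_sum, ← Finset.sum_add_distrib]
  refine Finset.sum_congr rfl fun m hm => ?_
  have hm0 : (a * m + b).toNat ≠ 0 := by have := hT m hm; omega
  push_cast
  rcases liouville_eq_one_or_eq_neg_one hm0 with h | h <;> rcases hν with rfl | rfl <;>
    simp [h] <;> norm_num

/-! ### Classes in an integer interval -/

/-- **A residue class in an integer interval**: for `d ≥ 1`,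
`|#{m ∈ [m₁, m₂] : m ≡ s (mod d)} − #[m₁, m₂]/d| ≤ 1`. [folklore] -/
theorem abs_card_Icc_filter_modEq_sub_le {d : ℕ} (hd : 0 < d) (m₁ m₂ s : ℤ) :
    |(#((Finset.Icc m₁ m₂).filter (fun m : ℤ => m ≡ s [ZMOD d])) : ℝ) -
      (#(Finset.Icc m₁ m₂) : ℝ) / d| ≤ 1 := by
  -- adapted from `Literature.NumberTheory.Sieve.BFI.abs_card_Ioc_filter_modEq_sub_le`
  rcases lt_or_ge m₂ m₁ with hlt | hle
  · rw [Finset.Icc_eq_empty (not_le.mpr hlt), Finset.filter_empty, Finset.card_empty, Nat.cast_zero,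
      zero_div, sub_zero, abs_zero]
    exact zero_le_one
  · have hIcc : Finset.Icc m₁ m₂ = Finset.Ioc (m₁ - 1) m₂ := by
      ext x; simp only [Finset.mem_Icc, Finset.mem_Ioc]; omega
    have hd' : (0 : ℤ) < d := by exact_mod_cast hd
    have hZ := Int.Ioc_filter_modEq_card (m₁ - 1) m₂ hd' s
    push_cast at hZ
    rw [hIcc]
    have hcard : (#(Finset.Ioc (m₁ - 1) m₂) : ℝ) = (m₂ : ℝ) - (m₁ - 1) := by
      rw [Int.card_Ioc]
      have h1 : (((m₂ - (m₁ - 1)).toNat : ℕ) : ℤ) = m₂ - (m₁ - 1) := Int.toNat_of_nonneg (by omega)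
      have h2 : (((m₂ - (m₁ - 1)).toNat : ℕ) : ℝ) = ((m₂ - (m₁ - 1) : ℤ) : ℝ) := by
        exact_mod_cast h1
      rw [h2]; push_cast; ring
    rw [hcard]
    set n := #((Finset.Ioc (m₁ - 1) m₂).filter (fun m : ℤ => m ≡ s [ZMOD d])) with hn
    set u : ℚ := ((m₂ : ℚ) - s) / d with hu
    set w : ℚ := ((m₁ : ℚ) - 1 - s) / d with hw
    have hdq : (0 : ℚ) < d := by exact_mod_cast hd
    have hm12 : (m₁ : ℚ) ≤ m₂ + 1 := by exact_mod_cast (show m₁ ≤ m₂ + 1 by omega)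
    have hwu : w ≤ u := div_le_div_of_nonneg_right (by linarith) hdq.le
    have hfl : ⌊w⌋ ≤ ⌊u⌋ := Int.floor_mono hwu
    have hmax : max (⌊u⌋ - ⌊w⌋) 0 = ⌊u⌋ - ⌊w⌋ := max_eq_left (sub_nonneg.2 hfl)
    rw [hmax] at hZ
    have h1 : (⌊u⌋ : ℚ) ≤ u := Int.floor_le u
    have h2 : u < ⌊u⌋ + 1 := Int.lt_floor_add_one u
    have h3 : (⌊w⌋ : ℚ) ≤ w := Int.floor_le w
    have h4 : w < ⌊w⌋ + 1 := Int.lt_floor_add_one w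
    have huw : u - w = ((m₂ : ℚ) - (m₁ - 1)) / d := by rw [hu, hw]; field_simp; ring
    have hQ : |((n : ℤ) : ℚ) - ((m₂ : ℚ) - (m₁ - 1)) / d| ≤ 1 := by
      rw [hZ, ← huw, abs_le]
      push_cast
      constructor <;> linarith
    have hR := (Rat.cast_le (K := ℝ)).2 hQ
    push_cast at hR
    exact hR

end Summit.Parity.GeneralizedHardyLittlewood.Theorems.AbsoluteUpgrade

end
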